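import Summits.NavierStokesRegularity.NavierStokesRegularity.Theorems.TypeICertificateLadderTargetMostTimesRung
import Literature.Analysis.Complex.AnnulusCrossing
import Mathlib.MeasureTheory.Integral.Layercake
import HarnessLib

/-!
# Crux `Target` = `TypeICertificateLadder.NoTypeIBlowup` (stmt-NavierStokesRegularity-1217), line
# `depletion-ladder`: the most-times rung in the FINAL-DENSITY currency of crux W3ᵐᵗ (stmt-19551)

`--supports stmt-NavierStokesRegularity-1217` (bridge from the route's density notion to the hypothesis of
`hasSmoothExtensionPast_of_twoLevelRate`).

The deciding crux `AprioriMostTimesBulkAlignment` (route ScaledTopAlignment) measures exceptional time sets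
`E` by their LINEAR final density: `|E ∩ (T−h, T)| ≤ θh` for all small `h`. The most-times rung
(`…TargetMostTimesRung.lean`) consumes the LOGARITHMIC density `∫_{E∩(0,t)} ds/(T−s) ≤ B' + θ log(T/(T−t))`.
Here the layer-cake formula converts the former into the latter with the SAME `θ` (sharp):

* `setLIntegral_inv_sub_le_of_finalDensity` — if `|E ∩ (T−h,T)| ≤ θh` for `0 < h ≤ h₀` then for
  `T − h₀ ≤ a < b < T`: `∫_{E∩(a,b)} ds/(T−s) ≤ θ + θ·log(h₀/(T−b))`
  (layer cake: `|{s ∈ E∩(a,b) : 1/(T−s) ≥ λ}| ≤ θ·min(h₀, 1/λ)` and `= 0` for `λ > 1/(T−b)`).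
* `logDensity_of_finalDensity` — hence the hypothesis of the two-level rung with `B' = T/h₀ + θ`.
* `hasSmoothExtensionPast_of_twoLevelRate_finalDensity` — **THE MOST-TIMES RUNG, W3ᵐᵗ CURRENCY**: a classical
  Leray–Hopf rapidly-decaying-datum solution whose Galilean rate is eventually `≤ C₂`, and `≤ C₁` off a measurable
  time set `E` with `|E ∩ (T−h,T)| ≤ θh` for all small `h` (verbatim the density clause of W3ᵐᵗ), extends past `T`
  as soon as `((2+√3)/9)²(C₁² + θ(C₂² − C₁²)) < 1`. Contrapositive: at a Type-I blow-up with envelope `C₂`, the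
  exceptional times above any `C₁ < 2.4115` have final density `> θ` for every `θ < (5.8155 − C₁²)/(C₂² − C₁²)`.

WHAT THIS IS NOT: measure-theoretic bookkeeping; no new analysis of the flow. [folklore]
-/

noncomputable section

open Set Filter Topology MeasureTheory
open scoped RealInnerProductSpace ENNReal NNReal
open Literature.Analysis.FluidPDE

namespace Summit.NavierStokesRegularity.NavierStokesRegularity.Theorems.DepletionLadder

-- the problem directory repeats the summit name (`NavierStokesRegularity/NavierStokesRegularity`)
set_option linter.dupNamespace false

/-- **Layer cake: linear final density controls the logarithmic integral.** Let `E ⊆ ℝ` be measurable with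
`|E ∩ (T−h, T)| ≤ θh` for all `0 < h ≤ h₀` (`θ ≥ 0`, `h₀ > 0`). Then for `T − h₀ ≤ a` and `a < b < T`:
`∫_{E ∩ (a,b)} ds/(T−s) ≤ θ + θ log(h₀/(T−b))`. Proof: `∫ f dμ = ∫₀^∞ μ{f ≥ λ} dλ` for `f(s) = 1/(T−s)` on
`μ = vol⌊(E∩(a,b))`; the super-level set is contained in `E ∩ (T − min(h₀,1/λ), T)` and is empty for
`λ > 1/(T−b)`; integrate `θh₀` over `(0, 1/h₀]` and `θ/λ` over `(1/h₀, 1/(T−b)]`. [folklore] -/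
theorem setLIntegral_inv_sub_le_of_finalDensity {T θ h₀ a b : ℝ} (hθ : 0 ≤ θ) (hh₀ : 0 < h₀)
    {E : Set ℝ} (hE : MeasurableSet E)
    (hdens : ∀ h : ℝ, 0 < h → h ≤ h₀ → volume (E ∩ Ioo (T - h) T) ≤ ENNReal.ofReal (θ * h))
    (ha : T - h₀ ≤ a) (hab : a < b) (hbT : b < T) :
    ∫⁻ s in E ∩ Ioo a b, ENNReal.ofReal (1 / (T - s)) ≤
      ENNReal.ofReal (θ + θ * Real.log (h₀ / (T - b))) := by
  set μ : Measure ℝ := volume.restrict (E ∩ Ioo a b) with hμ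
  have hmeasA : MeasurableSet (E ∩ Ioo a b) := hE.inter measurableSet_Ioo
  have hTb : 0 < T - b := sub_pos.2 hbT
  have hTbh : T - b ≤ h₀ := by linarith
  -- layer cake
  have f_nn : 0 ≤ᵐ[μ] fun s => 1 / (T - s) := by
    refine (ae_restrict_iff' hmeasA).2 (Eventually.of_forall fun s hs => ?_)
    have : 0 < T - s := by linarith [hs.2.2]
    positivity
  have f_mble : AEMeasurable (fun s : ℝ => 1 / (T - s)) μ :=
    (measurable_const.div (measurable_const.sub measurable_id)).aemeasurable
  rw [lintegral_eq_lintegral_meas_lt μ f_nn f_mble]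
  -- bound of the super-level sets
  set L : ℝ := 1 / (T - b) with hL
  have hL0 : 0 < L := by positivity
  have hLh : 1 / h₀ ≤ L := by
    rw [hL]; exact one_div_le_one_div_of_le hTb hTbh
  set g : ℝ → ℝ≥0∞ := fun lam =>
    if lam ≤ 1 / h₀ then ENNReal.ofReal (θ * h₀)
    else if lam ≤ L then ENNReal.ofReal (θ / lam) else 0 with hg
  have hlevel : ∀ lam ∈ Ioi (0 : ℝ), μ {s : ℝ | lam < 1 / (T - s)} ≤ g lam := by
    intro lam hlam
    have hlam0 : 0 < lam := hlam
    -- the strict super-level set lies inside `E ∩ (T − 1/lam, T)`, and is empty above `L`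
    have hsub : ∀ s, s ∈ E ∩ Ioo a b → lam < 1 / (T - s) → s ∈ E ∩ Ioo (T - 1 / lam) T := by
      intro s hs hlt
      have hTs : 0 < T - s := by linarith [hs.2.2]
      refine ⟨hs.1, ?_, by linarith [hs.2.2]⟩
      have h1 : T - s < 1 / lam := by
        rw [lt_div_iff₀ hlam0]
        have := (lt_div_iff₀ hTs).1 hlt
        linarith
      linarith
    rw [hμ, Measure.restrict_apply' hmeasA]
    by_cases h1 : lam ≤ 1 / h₀
    · -- `1/lam ≥ h₀`: use the density at `h₀`
      have hg1 : g lam = ENNReal.ofReal (θ * h₀) := by rw [hg]; simp only [if_pos h1]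
      rw [hg1]
      calc volume ({s : ℝ | lam < 1 / (T - s)} ∩ (E ∩ Ioo a b))
          ≤ volume (E ∩ Ioo (T - h₀) T) := by
            refine measure_mono fun s hs => ⟨hs.2.1, ?_, by linarith [hs.2.2.2]⟩
            linarith [hs.2.2.1]
        _ ≤ ENNReal.ofReal (θ * h₀) := hdens h₀ hh₀ le_rfl
    · by_cases h2 : lam ≤ L
      · have hg2 : g lam = ENNReal.ofReal (θ / lam) := by
          rw [hg]; simp only [if_neg h1, if_pos h2]
        rw [hg2]
        have hil : 0 < 1 / lam := by positivity
        have hil' : 1 / lam ≤ h₀ := by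
          have : 1 / h₀ < lam := not_le.mp h1
          rw [div_le_iff₀ hlam0]
          have := (div_lt_iff₀ hh₀).1 this
          linarith
        calc volume ({s : ℝ | lam < 1 / (T - s)} ∩ (E ∩ Ioo a b))
            ≤ volume (E ∩ Ioo (T - 1 / lam) T) :=
              measure_mono fun s hs => hsub s hs.2 hs.1
          _ ≤ ENNReal.ofReal (θ * (1 / lam)) := hdens (1 / lam) hil hil'
          _ = ENNReal.ofReal (θ / lam) := by rw [mul_one_div]
      · have hg3 : g lam = 0 := by rw [hg]; simp only [if_neg h1, if_neg h2]
        have hempty : {s : ℝ | lam < 1 / (T - s)} ∩ (E ∩ Ioo a b) = ∅ := by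
          refine Set.eq_empty_iff_forall_notMem.2 fun s hs => h2 ?_
          have hlt : lam < 1 / (T - s) := hs.1
          have hle2 : 1 / (T - s) ≤ L := by
            rw [hL]; exact one_div_le_one_div_of_le hTb (by linarith [hs.2.2.2])
          exact (hlt.trans_le hle2).le
        rw [hg3, hempty, measure_empty]
  -- the three pieces of `∫ g`
  have hI1 : ∫⁻ lam in Ioc 0 (1 / h₀), g lam = ENNReal.ofReal θ := by
    calc ∫⁻ lam in Ioc 0 (1 / h₀), g lam = ∫⁻ lam in Ioc 0 (1 / h₀), ENNReal.ofReal (θ * h₀) :=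
          setLIntegral_congr_fun measurableSet_Ioc fun lam hlam => by
            rw [hg]; simp only [if_pos hlam.2]
      _ = ENNReal.ofReal (θ * h₀) * volume (Ioc (0 : ℝ) (1 / h₀)) := setLIntegral_const _ _
      _ = ENNReal.ofReal θ := by
          rw [Real.volume_Ioc, sub_zero, ← ENNReal.ofReal_mul (by positivity),
            show θ * h₀ * (1 / h₀) = θ by field_simp]
  have hI2 : ∫⁻ lam in Ioc (1 / h₀) L, g lam = ENNReal.ofReal (θ * Real.log (h₀ / (T - b))) := by
    have hfun : ∀ lam ∈ Ioc (1 / h₀) L, g lam = ENNReal.ofReal θ * ENNReal.ofReal lam⁻¹ := by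
      intro lam hlam
      have h1 : ¬ lam ≤ 1 / h₀ := not_le.2 hlam.1
      rw [hg]; simp only [if_neg h1, if_pos hlam.2]
      rw [← ENNReal.ofReal_mul hθ, div_eq_mul_inv]
    calc ∫⁻ lam in Ioc (1 / h₀) L, g lam
        = ∫⁻ lam in Ioc (1 / h₀) L, ENNReal.ofReal θ * ENNReal.ofReal lam⁻¹ :=
          setLIntegral_congr_fun measurableSet_Ioc hfun
      _ = ∫⁻ lam in Ioo (1 / h₀) L, ENNReal.ofReal θ * ENNReal.ofReal lam⁻¹ :=
          setLIntegral_congr Ioo_ae_eq_Ioc.symm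
      _ = ENNReal.ofReal θ * ENNReal.ofReal (Real.log (L / (1 / h₀))) := by
          rw [lintegral_const_mul' _ _ ENNReal.ofReal_ne_top,
            Literature.Analysis.Complex.AnnulusCrossing.lintegral_inv_Ioo (by positivity) hLh]
      _ = ENNReal.ofReal (θ * Real.log (h₀ / (T - b))) := by
          rw [← ENNReal.ofReal_mul hθ, hL]
          congr 3
          field_simp
  have hI3 : ∫⁻ lam in Ioi L, g lam = 0 := by
    have hfun : ∀ lam ∈ Ioi L, g lam = 0 := by
      intro lam hlam
      have hlam' : L < lam := hlam
      have h1 : ¬ lam ≤ 1 / h₀ := not_le.2 (hLh.trans_lt hlam')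
      have h2 : ¬ lam ≤ L := not_le.2 hlam'
      rw [hg]; simp only [if_neg h1, if_neg h2]
    calc ∫⁻ lam in Ioi L, g lam = ∫⁻ lam in Ioi L, (0 : ℝ≥0∞) :=
          setLIntegral_congr_fun measurableSet_Ioi hfun
      _ = 0 := lintegral_zero
  -- integrate the bound
  have hsplit1 : ∫⁻ lam in Ioi 0, g lam =
      (∫⁻ lam in Ioc 0 (1 / h₀), g lam) + ∫⁻ lam in Ioi (1 / h₀), g lam := by
    rw [← lintegral_union measurableSet_Ioi (Ioc_disjoint_Ioi_same), Ioc_union_Ioi_eq_Ioi (by positivity)]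
  have hsplit2 : ∫⁻ lam in Ioi (1 / h₀), g lam =
      (∫⁻ lam in Ioc (1 / h₀) L, g lam) + ∫⁻ lam in Ioi L, g lam := by
    rw [← lintegral_union measurableSet_Ioi (Ioc_disjoint_Ioi_same), Ioc_union_Ioi_eq_Ioi hLh]
  calc ∫⁻ lam in Ioi 0, μ {s : ℝ | lam < 1 / (T - s)}
      ≤ ∫⁻ lam in Ioi 0, g lam := setLIntegral_mono' measurableSet_Ioi hlevel
    _ = ENNReal.ofReal θ + (ENNReal.ofReal (θ * Real.log (h₀ / (T - b))) + 0) := by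
        rw [hsplit1, hsplit2, hI1, hI2, hI3]
    _ = ENNReal.ofReal (θ + θ * Real.log (h₀ / (T - b))) := by
        rw [add_zero, ENNReal.ofReal_add hθ]
        exact mul_nonneg hθ (Real.log_nonneg ((one_le_div hTb).2 hTbh))

/-- **Linear final density ⇒ logarithmic density** (the hypothesis of the two-level rung). If
`|E ∩ (T−h, T)| ≤ θh` for all `0 < h ≤ h₀` with `0 < h₀ ≤ T`, `θ ≥ 0`, `E` measurable, then for every
`t ∈ (0,T)`: `∫_{(0,t)} 𝟙_E(s) ds/(T−s) ≤ (T/h₀ + θ) + θ log(T/(T−t))` — the part before `T − h₀` is at most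
`T/h₀`, the part after it is the layer-cake bound with `log(h₀/(T−t)) ≤ log(T/(T−t))`. [folklore] -/
theorem logDensity_of_finalDensity {T θ h₀ : ℝ} (hθ : 0 ≤ θ) (hh₀ : 0 < h₀) (hh₀T : h₀ ≤ T)
    {E : Set ℝ} (hE : MeasurableSet E)
    (hdens : ∀ h : ℝ, 0 < h → h ≤ h₀ → volume (E ∩ Ioo (T - h) T) ≤ ENNReal.ofReal (θ * h)) :
    ∀ t ∈ Ioo 0 T, ∫⁻ s in Ioo 0 t, E.indicator (fun s => ENNReal.ofReal (1 / (T - s))) s ≤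
      ENNReal.ofReal ((T / h₀ + θ) + θ * Real.log (T / (T - t))) := by
  intro t ht
  have hT : 0 < T := ht.1.trans ht.2
  have hTt : 0 < T - t := sub_pos.2 ht.2
  have hlogT : 0 ≤ Real.log (T / (T - t)) := Real.log_nonneg ((one_le_div hTt).2 (by linarith [ht.1]))
  -- split `(0,t)` at `c = max (T − h₀) (t/2)`... simpler: at `c = T − h₀` when `T − h₀ < t`, else all early
  by_cases hearly : t ≤ T - h₀
  · -- everything is before `T − h₀`: integrand ≤ 1/h₀
    calc ∫⁻ s in Ioo 0 t, E.indicator (fun s => ENNReal.ofReal (1 / (T - s))) s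
        ≤ ∫⁻ s in Ioo 0 t, ENNReal.ofReal (1 / h₀) := by
          refine setLIntegral_mono' measurableSet_Ioo fun s hs => ?_
          refine (indicator_le_self _ _ s).trans (ENNReal.ofReal_le_ofReal ?_)
          exact one_div_le_one_div_of_le hh₀ (by linarith [hs.2])
      _ = ENNReal.ofReal (1 / h₀ * t) := by
          rw [setLIntegral_const, Real.volume_Ioo, sub_zero, ← ENNReal.ofReal_mul (by positivity)]
      _ ≤ ENNReal.ofReal ((T / h₀ + θ) + θ * Real.log (T / (T - t))) := by
          refine ENNReal.ofReal_le_ofReal ?_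
          have h1 : 1 / h₀ * t ≤ T / h₀ := by
            rw [one_div_mul_eq_div]; exact div_le_div_of_nonneg_right ht.2.le hh₀.le
          nlinarith [mul_nonneg hθ hlogT]
  · have hct : T - h₀ < t := not_le.mp hearly
    set c : ℝ := max (T - h₀) 0 with hc
    have hc0 : 0 ≤ c := le_max_right _ _
    have hct' : c < t := max_lt hct ht.1
    have hcT : T - h₀ ≤ c := le_max_left _ _
    -- split the domain
    have hsplit : Ioo 0 t ⊆ Ioc 0 c ∪ Ioo c t := fun s hs => by
      by_cases h : s ≤ c
      · exact Or.inl ⟨hs.1, h⟩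
      · exact Or.inr ⟨not_le.mp h, hs.2⟩
    calc ∫⁻ s in Ioo 0 t, E.indicator (fun s => ENNReal.ofReal (1 / (T - s))) s
        ≤ ∫⁻ s in Ioc 0 c ∪ Ioo c t, E.indicator (fun s => ENNReal.ofReal (1 / (T - s))) s :=
          lintegral_mono_set hsplit
      _ ≤ (∫⁻ s in Ioc 0 c, E.indicator (fun s => ENNReal.ofReal (1 / (T - s))) s) +
            ∫⁻ s in Ioo c t, E.indicator (fun s => ENNReal.ofReal (1 / (T - s))) s :=
          lintegral_union_le _ _ _
      _ ≤ ENNReal.ofReal (T / h₀) + ENNReal.ofReal (θ + θ * Real.log (h₀ / (T - t))) := by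
          gcongr
          · -- early part: integrand ≤ 1/h₀ on `(0, c]`, `c ≤ T − h₀` or `c = 0`
            calc ∫⁻ s in Ioc 0 c, E.indicator (fun s => ENNReal.ofReal (1 / (T - s))) s
                ≤ ∫⁻ s in Ioc 0 c, ENNReal.ofReal (1 / h₀) := by
                  refine setLIntegral_mono' measurableSet_Ioc fun s hs => ?_
                  refine (indicator_le_self _ _ s).trans (ENNReal.ofReal_le_ofReal ?_)
                  have hsc : s ≤ T - h₀ := by
                    rcases le_total (T - h₀) 0 with h | h
                    · have : c = 0 := by rw [hc, max_eq_right h]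
                      linarith [hs.1, hs.2]
                    · have : c = T - h₀ := by rw [hc, max_eq_left h]
                      linarith [hs.2]
                  exact one_div_le_one_div_of_le hh₀ (by linarith)
              _ = ENNReal.ofReal (1 / h₀ * c) := by
                  rw [setLIntegral_const, Real.volume_Ioc, sub_zero, ← ENNReal.ofReal_mul (by positivity)]
              _ ≤ ENNReal.ofReal (T / h₀) := by
                  refine ENNReal.ofReal_le_ofReal ?_
                  rw [one_div_mul_eq_div]
                  exact div_le_div_of_nonneg_right (hct'.le.trans ht.2.le) hh₀.le
          · -- late part: layer cake on `E ∩ (c, t)`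
            rw [lintegral_indicator hE, Measure.restrict_restrict hE]
            exact setLIntegral_inv_sub_le_of_finalDensity hθ hh₀ hE hdens hcT hct' ht.2
      _ = ENNReal.ofReal (T / h₀ + (θ + θ * Real.log (h₀ / (T - t)))) := by
          rw [← ENNReal.ofReal_add (by positivity)]
          exact add_nonneg hθ (mul_nonneg hθ (Real.log_nonneg ((one_le_div hTt).2 (by linarith))))
      _ ≤ ENNReal.ofReal ((T / h₀ + θ) + θ * Real.log (T / (T - t))) := by
          refine ENNReal.ofReal_le_ofReal ?_
          have hlog : Real.log (h₀ / (T - t)) ≤ Real.log (T / (T - t)) :=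
            Real.log_le_log (by positivity) (div_le_div_of_nonneg_right hh₀T hTt.le)
          nlinarith [mul_le_mul_of_nonneg_left hlog hθ]

/-- **THE MOST-TIMES RUNG IN W3ᵐᵗ CURRENCY.** Let `u` be a classical solution of the unforced
Navier–Stokes system on `ℝ³ × [0,T)` (`ν, T > 0`), Leray–Hopf from its rapidly decaying datum; let
`0 ≤ t₁ < T`, `0 < C₁ ≤ C₂`, `0 ≤ θ` and a measurable set `E ⊆ ℝ` of times with
* for `t ∈ [t₁,T) ∩ E` some constant vector `c` has `√(T−t)·|u(t,x) − c| ≤ C₂√ν` for all `x`;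
* for `t ∈ [t₁,T) \ E` some constant vector `c` has `√(T−t)·|u(t,x) − c| ≤ C₁√ν` for all `x`;
* FINAL DENSITY of `E` at most `θ`: for some `h₀ > 0`, `|E ∩ (T−h, T)| ≤ θh` for all `0 < h < h₀`
  (verbatim the density clause of crux W3ᵐᵗ stmt-NavierStokesRegularity-19551);
* `((2+√3)/9)² · (C₁² + θ(C₂² − C₁²)) < 1`.
Then `u` extends to a classical solution past `T`. [folklore] -/
theorem hasSmoothExtensionPast_of_twoLevelRate_finalDensity {ν T t₁ C₁ C₂ θ : ℝ} (hν : 0 < ν)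
    (hT : 0 < T) (ht₁ : t₁ ∈ Ico 0 T) (hC₁ : 0 < C₁) (hC₁₂ : C₁ ≤ C₂) (hθ : 0 ≤ θ)
    {E : Set ℝ} (hE : MeasurableSet E)
    (hA1 : ((2 + Real.sqrt 3) / 9) ^ 2 * (C₁ ^ 2 + θ * (C₂ ^ 2 - C₁ ^ 2)) < 1)
    {u : ℝ → EuclideanSpace ℝ (Fin 3) → EuclideanSpace ℝ (Fin 3)}
    {p : ℝ → EuclideanSpace ℝ (Fin 3) → ℝ}
    (hsol : IsClassicalNSSolutionOn (Ico 0 T) ν 0 u p) (hLH : IsLerayHopfOn T ν 0 (u 0) u)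
    (hdec : HasRapidSpatialDecay (u 0))
    (henv : ∀ t ∈ Ico t₁ T, t ∈ E → ∃ c : EuclideanSpace ℝ (Fin 3), ∀ x,
      Real.sqrt (T - t) * ‖u t x - c‖ ≤ C₂ * Real.sqrt ν)
    (hgood : ∀ t ∈ Ico t₁ T, t ∉ E → ∃ c : EuclideanSpace ℝ (Fin 3), ∀ x,
      Real.sqrt (T - t) * ‖u t x - c‖ ≤ C₁ * Real.sqrt ν)
    (hdens : ∃ h₀ : ℝ, 0 < h₀ ∧ ∀ h : ℝ, 0 < h → h < h₀ →
      volume (E ∩ Ioo (T - h) T) ≤ ENNReal.ofReal (θ * h)) :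
    HasSmoothExtensionPast ν 0 u T := by
  obtain ⟨h₀, hh₀, hd⟩ := hdens
  -- shrink to `h₁ = min (h₀/2) T` so that the density holds for `h ≤ h₁` and `h₁ ≤ T`
  set h₁ : ℝ := min (h₀ / 2) T with hh₁
  have hh₁0 : 0 < h₁ := lt_min (by positivity) hT
  have hh₁T : h₁ ≤ T := min_le_right _ _
  have hd' : ∀ h : ℝ, 0 < h → h ≤ h₁ → volume (E ∩ Ioo (T - h) T) ≤ ENNReal.ofReal (θ * h) :=
    fun h hh hle => hd h hh (lt_of_le_of_lt (hle.trans (min_le_left _ _)) (by linarith))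
  exact hasSmoothExtensionPast_of_twoLevelRate hν hT ht₁ hC₁ hC₁₂ hθ (by positivity : 0 ≤ T / h₁ + θ)
    hA1 hsol hLH hdec henv hgood (logDensity_of_finalDensity hθ hh₁0 hh₁T hE hd')

end Summit.NavierStokesRegularity.NavierStokesRegularity.Theorems.DepletionLadder

end
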